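import Literature.AnabelianGeometry.SemiGraphs.TemperedAnabelianThm64SubProofs
import Literature.AnabelianGeometry.SemiGraphs.TemperedAnabelianThm64OfTowerProofs
import Literature.AnabelianGeometry.SemiGraphs.TemperedAnabelianTowerWitnessCurve

/-!
# [SemiAnbd] Thm. 6.4 sub-DAG: rows T64-L06′ / T64-L07 (and T64-L02) hold at the NON-COMPACT tower witness

S. Mochizuki, *Semi-graphs of anabelioids*, Publ. RIMS **42** (2006) [SemiAnbd], §6, Lemma 6.3 (ii)/(iii)
p. 70 and the proof of Theorem 6.4 p. 71 ("by Lemma 6.3, (iii), we thus conclude that `φ` differs from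
`ψ` by composition with an inner automorphism of `Π^temp_{Y_L}`").
[cite: MochizukiSemiAnbd2006, Lem 6.3(iii) p.70, Thm 6.4 proof p.71]

PROOF-ONLY companion (theorems only; no definition, no new fact) of `TemperedAnabelianThm64Sub.lean`
(abc-iut-w5-d139), complementing `TemperedAnabelianThm64SubCompactCase.lean` (abc-iut-w4-d076: the rows
at the DEGENERATE, profinite inhabitant).  Cell abc-iut, seat abc-iut-w4-d076, frozen FACT-LIST rows
F-2837 `TemperedCurve.OpenDenseDOFConjugator` (T64-L06′ = Lemma 6.3 (iii) at the finite étale coverings)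
and F-2838 `TemperedCurve.OuterDescent` (T64-L07).

In the tree these rows are PROVED MODULO the structural inputs about `Π^temp_{Y_L}` — `IsTempered`
([SemiAnbd] Def. 3.1 (i)) and the virtually-free tower input `htower₀` ([André] §4.5) — by
abc-iut-w5-d240 (`TemperedCurve.openDenseDOFConjugator_of_tower`, `TemperedAnabelianSec6OfTowerProofs.lean`),
and abc-iut-w5-d240 also exhibited a NON-COMPACT datum of the interface `TemperedCurve p` satisfying
exactly these inputs (`exists_temperedCurve_isTempered_tower`, `TemperedAnabelianTowerWitnessCurve.lean`:
`Π^temp := F₂ × G_{ℚ_p}` with `F₂` DISCRETE free of rank two and `G_{ℚ_p}` profinite, `Π := F̂₂ × G_{ℚ_p}`).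
This file merely COMPOSES the two:

* `exists_noncompact_openDenseDOFConjugator` — there is a datum `Y : TemperedCurve p` with `Π^temp_{Y_L}`
  tempered and NOT compact at which T64-L06′ (`OpenDenseDOFConjugator`), T64-L07 (`OuterDescent X Y`
  for every `X`) and T64-L02 (`PiTempDFGIffDOF`, Lemma 6.3 (ii)) all hold — i.e. the FACT-LIST reading
  "instance form MODEL-WITNESSED" for F-2837 / F-2838 at a witness where the statement is NOT the
  triviality `Π^temp = Π` (there, Lemma 6.3 (iii) is the free-group content [SemiAnbd] Lem. 6.1 (i) /
  [EtTh] Lem. 2.17 (i), kernel-proved in the tree);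
* `exists_noncompact_temperedAnabelianTheorem_of_inputs` — at that datum the sharpened assembly of
  Thm. 6.4 needs only the `π₁^temp`-functor clauses T64-L01/L01b and [Mzk8] Thm. 1.2 (T64-L04).

HONEST LIMITS.  Consistency evidence only: `F₂ × G_{ℚ_p}` is not the tempered fundamental group of a
hyperbolic curve (no closed points; the geometric part is a direct factor); nothing of [SemiAnbd] /
[André] / [Mzk8] is asserted or denied; nothing here takes a side on [IUTchIII] Cor. 3.12.
-/

noncomputable section

namespace Literature.AnabelianGeometry.SemiGraphs

namespace TemperedCurve

open _root_.Topology

/-- **F-2837 / F-2838 (and Lemma 6.3 (ii)) MODEL-WITNESSED at a non-compact tempered datum.**  There is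
`Y : TemperedCurve p` with `Π^temp_{Y_L}` tempered and not compact such that Lemma 6.3 (iii) at the
coverings (`OpenDenseDOFConjugator`), the outer descent T64-L07 against every source `X`, and Lemma 6.3
(ii) (`PiTempDFGIffDOF`) hold — the tower witness of abc-iut-w5-d240 fed into the tower proofs.
[cite: MochizukiSemiAnbd2006, Lem 6.3(iii) p.70, Thm 6.4 proof p.71] -/
theorem exists_noncompact_openDenseDOFConjugator (p : ℕ) [Fact p.Prime] :
    ∃ Y : TemperedCurve p, IsTempered Y.PiTemp ∧ ¬ CompactSpace Y.PiTemp ∧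
      Y.OpenDenseDOFConjugator ∧ (∀ X : TemperedCurve p, OuterDescent X Y) ∧ Y.PiTempDFGIffDOF := by
  obtain ⟨Y, hT, hnc, htower⟩ := exists_temperedCurve_isTempered_tower (p := p)
  have h06 : Y.OpenDenseDOFConjugator := Y.openDenseDOFConjugator_of_tower hT htower
  exact ⟨Y, hT, hnc, h06, fun X => outerDescent_of_openDenseDOFConjugator X Y h06,
    Y.piTempDFGIffDOF_of_tower htower⟩

/-- At the same non-compact datum, [SemiAnbd] Thm. 6.4 (`TemperedAnabelianTheorem C`) follows from the
`π₁^temp`-functor clauses T64-L01 / T64-L01b and [Mzk8] Thm. 1.2 (T64-L04) ALONE, for every source `X`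
and every morphism datum `C` (hypotheses by name; typed ≠ proved).
[cite: MochizukiSemiAnbd2006, Thm 6.4 pp.70-71] -/
theorem exists_noncompact_temperedAnabelianTheorem_of_inputs (p : ℕ) [Fact p.Prime] :
    ∃ Y : TemperedCurve p, IsTempered Y.PiTemp ∧ ¬ CompactSpace Y.PiTemp ∧
      ∀ (X : TemperedCurve p) (C : TemperedCurveHom p X Y),
        GeometricIsDFG C → GeometricIsGaloisCompatible C → ProfiniteAnabelianTheorem C →
          TemperedAnabelianTheorem C := by
  obtain ⟨Y, hT, hnc, htower⟩ := exists_temperedCurve_isTempered_tower (p := p)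
  exact ⟨Y, hT, hnc, fun X C h01 h01b h04 =>
    temperedAnabelianTheorem_of_tower C h01 h01b h04 hT htower⟩

end TemperedCurve

end Literature.AnabelianGeometry.SemiGraphs

end
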